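import Literature.Claims.NS.Permana2026
import Summits.NavierStokesRegularity.NavierStokesRegularity.Theorems.SoloRefuteLucardoOlivaes2026
import Literature.Analysis.FluidPDE.CKNInterpolationEstimate
import Literature.Analysis.FluidPDE.TaoEnstrophyLocalisationProofs
import HarnessLib

/-!
# D-0090 NS-CLAIMS, claim C119 `Permana2026` — kernel countermodel to the typed step (24) ⇒ (25)

Cell `ns-claims`; refuter of record `ns-claims-refuter-1` (g4) (typist `ns-claims-typist-11` g6, referee
`ns-claims-ref-3` g5, second refuter `ns-claims-refuter-5` g3, UG-audit `ns-claims-refuter-7` g3, filer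
`ns-claims-salvage-p1` g3). Source: B. P. Permana, S. A. Ibrahim, H. A. Lathief, Zenodo concept
10.5281/zenodo.19582630, TEXT OF RECORD v1 = record 19582631 (8 pp., PDF e99057ab464ac326), skeleton
`Literature.Claims.NS.Permana2026` (typist-11 g6, 398 l., sha16 c7c64ed6ff0e0ded).

`not_Step_8 : ¬ Step_8` — §6.2 p.6 l.21–31, the passage from (24) to (25): «By standard elliptic regularity, the
H² norm of vorticity is controlled by the dissipation term. Squaring (24) and integrating over the interval
[0,T*): ∫₀^{T*}‖ω‖_{L∞} ≤ C_BGW ∫₀^{T*} E(t)^{1/2} √(log(e + C_ν t)) dt (25)», typed (F15, the integrand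
replacement the lines perform) as `Step_8`: for every `ν > 0` some `C_ν ≥ 0` with
`‖ω‖_{H¹} √log(e + ‖ω‖_{H²}) ≤ E^{1/2} √log(e + C_ν t)` along every class solution at every `t ∈ [0,T)`.
It is false at `t = 0` along the class solution launched (tree theorem, Majda–Bertozzi Thm. 3.4, via
`LucardoOlivaes2026.exists_isLocalSolution`) by ANY datum with non-constant vorticity — here the tree's swirling
bump `LucardoOlivaes2026.u0`: at `t = 0` the right side is `E(0)^{1/2}·√log e = E(0)^{1/2}` while the left side is
`(E(0) + ‖∇ω₀‖²_{L²})^{1/2} · √log(e + ‖ω₀‖_{H²}) ≥ (E(0) + ‖∇ω₀‖²_{L²})^{1/2} > E(0)^{1/2}` because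
`‖∇ω₀‖²_{L²} > 0` (`LucardoOlivaes2026.palin_pos`). The `H¹` norm in front of the logarithm in (24) carries
`‖∇ω‖_{L²}`, which (25) silently drops; no constant `C_ν` repairs this at `t = 0`.

This is a COMPANION object on the printed path (the composition `claim_of_steps` consumes `Step_8`); the
refuter's locator of record is `Step_3` = Lemma 3.1 (7) p.3 (see the VERDICT line); nothing here adjudicates
`Step_3`, `Step_5` or `Step_7`.

WHAT THIS IS NOT: not a claim about NS regularity or blow-up; not a claim about any author beyond the typed
locator.
-/

-- The summit's canonical theorem namespace repeats the summit name (single-conjunct summit).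
set_option linter.dupNamespace false

noncomputable section

open Real Set Function MeasureTheory
open scoped ContDiff ENNReal NNReal

namespace Summit.NavierStokesRegularity.NavierStokesRegularity.Theorems.Permana2026

open Literature.Analysis.FluidPDE
open Literature.Claims.NS.Chae2007 (IsDatum IsLocalSolution)
open Literature.Claims.NS.Permana2026
open Summit.NavierStokesRegularity.NavierStokesRegularity.Theorems.LucardoOlivaes2026
  (u0 isOuroDatum_u0 palin_pos exists_isLocalSolution)

/-- `‖∇ω₀‖²_{L²} > 0` for the swirling bump, in the skeleton's `lintegral` encoding: the lower integral of
`‖∇ curl u₀‖ₑ²` is the (positive, finite) Bochner integral of `‖∇ curl u₀‖²`. [folklore] -/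
theorem toReal_lintegral_fderiv_curl_u0_pos :
    0 < (∫⁻ x, ‖fderiv ℝ (curl u0) x‖ₑ ^ 2).toReal := by
  have hv := isOuroDatum_u0
  have h1 : ContDiff ℝ 1 (curl u0) := contDiff_curl (n := 1) (hv.1.1.of_le (by exact_mod_cast le_top))
  have hc : Continuous fun x => ‖fderiv ℝ (curl u0) x‖ ^ 2 := (h1.continuous_fderiv (by simp)).norm.pow 2
  have hcs : HasCompactSupport fun x => ‖fderiv ℝ (curl u0) x‖ ^ 2 :=
    ((hv.2.1.fderiv (𝕜 := ℝ)).norm).comp_left (g := fun r : ℝ => r ^ 2) (by simp)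
  have hint : Integrable (fun x => ‖fderiv ℝ (curl u0) x‖ ^ 2) := hc.integrable_of_hasCompactSupport hcs
  have heq : ∫⁻ x, ‖fderiv ℝ (curl u0) x‖ₑ ^ 2 = ENNReal.ofReal (∫ x, ‖fderiv ℝ (curl u0) x‖ ^ 2) := by
    rw [ofReal_integral_eq_lintegral_ofReal hint (Filter.Eventually.of_forall fun x => sq_nonneg _)]
    refine lintegral_congr fun x => ?_
    rw [← ofReal_norm, ENNReal.ofReal_pow (norm_nonneg _)]
  rw [heq, ENNReal.toReal_ofReal (integral_nonneg fun x => sq_nonneg _)]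
  exact palin_pos isOuroDatum_u0

/-- The same positivity in the Frobenius (Hilbert–Schmidt) encoding `∫ |∇ curl u₀|²_F` of the skeleton's rev 2
(`gradVortSq` re-based on `frobeniusNormSq`, the printed `Σᵢ|∂ᵢω|²` of (20)): `‖L‖²_op ≤ |L|²_F`
(`sq_opNorm_le_frobeniusNormSq`). Either encoding feeds `not_Step_8` (the proof tries both). [folklore] -/
theorem toReal_lintegral_frobeniusNormSq_fderiv_curl_u0_pos :
    0 < (∫⁻ x, ENNReal.ofReal (frobeniusNormSq (fderiv ℝ (curl u0) x))).toReal := by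
  have hv := isOuroDatum_u0
  have h1 : ContDiff ℝ 1 (curl u0) := contDiff_curl (n := 1) (hv.1.1.of_le (by exact_mod_cast le_top))
  have hD : Continuous fun x => fderiv ℝ (curl u0) x := h1.continuous_fderiv (by simp)
  have hc : Continuous fun x => ‖fderiv ℝ (curl u0) x‖ ^ 2 := hD.norm.pow 2
  have hcs : HasCompactSupport fun x => ‖fderiv ℝ (curl u0) x‖ ^ 2 :=
    ((hv.2.1.fderiv (𝕜 := ℝ)).norm).comp_left (g := fun r : ℝ => r ^ 2) (by simp)
  have hint : Integrable (fun x => ‖fderiv ℝ (curl u0) x‖ ^ 2) := hc.integrable_of_hasCompactSupport hcs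
  have hcF : Continuous fun x => frobeniusNormSq (fderiv ℝ (curl u0) x) :=
    continuous_frobeniusNormSq'.comp hD
  have hcsF : HasCompactSupport fun x => frobeniusNormSq (fderiv ℝ (curl u0) x) :=
    (hv.2.1.fderiv (𝕜 := ℝ)).comp_left (g := fun L => frobeniusNormSq L) frobeniusNormSq_zero
  have hintF : Integrable (fun x => frobeniusNormSq (fderiv ℝ (curl u0) x)) :=
    hcF.integrable_of_hasCompactSupport hcsF
  have heq : ∫⁻ x, ENNReal.ofReal (frobeniusNormSq (fderiv ℝ (curl u0) x)) =
      ENNReal.ofReal (∫ x, frobeniusNormSq (fderiv ℝ (curl u0) x)) :=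
    (ofReal_integral_eq_lintegral_ofReal hintF
      (Filter.Eventually.of_forall fun x => frobeniusNormSq_nonneg _)).symm
  rw [heq, ENNReal.toReal_ofReal (integral_nonneg fun x => frobeniusNormSq_nonneg _)]
  calc (0:ℝ) < ∫ x, ‖fderiv ℝ (curl u0) x‖ ^ 2 := palin_pos isOuroDatum_u0
    _ ≤ ∫ x, frobeniusNormSq (fderiv ℝ (curl u0) x) :=
        integral_mono hint hintF fun x => sq_opNorm_le_frobeniusNormSq _

/-- **(24) ⇒ (25), §6.2 p.6 l.21–31, fails as typed (`Step_8`)**: at `t = 0` along the class solution from the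
swirling bump `u₀` (any `ν > 0`; here `ν = 1`), `‖ω₀‖_{H¹}√log(e + ‖ω₀‖_{H²}) ≥ (E(0) + ‖∇ω₀‖²)^{1/2} > E(0)^{1/2}
= E(0)^{1/2}√log(e + C_ν·0)` for every `C_ν`. Grain note (referee ns-claims-ref-3 g5): the printed (25) is an
INTEGRATED inequality over the solution's interval; this theorem refutes the typed pointwise integrand reading of
the passage (24) → (25), not the integrated display, which stands as unfilled (non-sequitur) — a print-faithful
kill of the integrated form needs the small-interval dilation argument. [cite: Permana2026, (24)–(25) p.6 l.21–31] -/
theorem not_Step_8 : ¬ Step_8 := by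
  intro h
  obtain ⟨Cν, -, hC⟩ := h 1 one_pos
  obtain ⟨T, hT, u, p, hsol⟩ := exists_isLocalSolution zero_le_one isOuroDatum_u0.1
  have key := hC T hT u0 u p hsol 0 ⟨le_rfl, hT⟩
  rw [mul_zero, add_zero, Real.log_exp, Real.sqrt_one, mul_one] at key
  -- the quantities at `t = 0` are those of the datum
  have h0 : u 0 = u0 := hsol.initial
  set E : ℝ := enstrophy u 0 with hE
  set G : ℝ := gradVortSq u 0 with hG
  have hE0 : 0 ≤ E := ENNReal.toReal_nonneg
  have hG0 : 0 < G := by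
    rw [hG, gradVortSq, h0]
    -- operator-norm encoding (skeleton rev 1) or Frobenius encoding (rev 2): either helper closes it
    first
      | exact toReal_lintegral_fderiv_curl_u0_pos
      | exact toReal_lintegral_frobeniusNormSq_fderiv_curl_u0_pos
  have hlog : 1 ≤ Real.sqrt (Real.log (Real.exp 1 + h2Vort u 0)) := by
    have h2 : 0 ≤ h2Vort u 0 := Real.sqrt_nonneg _
    have h3 : (1:ℝ) ≤ Real.log (Real.exp 1 + h2Vort u 0) := by
      calc (1:ℝ) = Real.log (Real.exp 1) := (Real.log_exp 1).symm
        _ ≤ Real.log (Real.exp 1 + h2Vort u 0) := Real.log_le_log (Real.exp_pos 1) (by linarith)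
    have h4 := Real.sqrt_le_sqrt h3
    rwa [Real.sqrt_one] at h4
  have h1 : h1Vort u 0 = Real.sqrt (E + G) := rfl
  have hlt : Real.sqrt E < Real.sqrt (E + G) := Real.sqrt_lt_sqrt hE0 (by linarith)
  have hge : Real.sqrt (E + G) ≤ h1Vort u 0 * Real.sqrt (Real.log (Real.exp 1 + h2Vort u 0)) := by
    rw [h1]
    exact le_mul_of_one_le_right (Real.sqrt_nonneg _) hlog
  linarith

end Summit.NavierStokesRegularity.NavierStokesRegularity.Theorems.Permana2026

/-! FQN guard (type-exactness against the skeleton decl). -/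
example : ¬ Literature.Claims.NS.Permana2026.Step_8 :=
  Summit.NavierStokesRegularity.NavierStokesRegularity.Theorems.Permana2026.not_Step_8
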